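import Literature.Combinatorics.SimpleGraph.TreeRetractionOntoSubtree   -- ★ `TreeRetraction.exists_retraction` (height ∕ parent toward a subtree: the data `(h, p)` below)
import Mathlib.Tactic.Ring
import HarnessLib

/-!
# Layer counts around a subtree of a locally finite tree: `#L_{k+1} = Σ_{v ∈ L_k} (deg v − 1)`, the two-type recursion, and the spheres of a bi-regular tree
# (Serre, *Trees* I.2.3; the sphere counts `C_k(γ)` of the Bruhat–Tits tree of `U(2,1)`)

Topic `Combinatorics/SimpleGraph`; namespace `Literature.Combinatorics.SimpleGraph.TreeLayers`.  THEOREMS ONLY (no definition, no instance, no notation, no named fact,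
no `sorry`); Mathlib + ★ `TreeRetractionOntoSubtree`; arbitrary vertex type, `G` locally finite.  Cell `pub/hodgecm-mathlib`, F0∕P3a, crux H413 = `stmt-HodgeConjecture-24833`,
line «N6nsGerm», residue `stub_N6nsS3id`, road «S3-tree» (census «S3» v2 §4 (R-T)): architect A-p16 (g28) WORD S3-W2 «`O(γ, 1_{Kt^kK}) ∝ C_k(γ) = #{type-0 L : d(L, Fix γ) = k}`
(sphere counts around the fixed subtree) … T2 fixed subtree + SPHERE COUNTS `C_k(γ)`»; with ★ `TreeAutomorphismDisplacement` (`{v | d(v, γv) = 2k} = {v | h v = k}`, F0P3a-p08 (g17))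
this file makes `C_k(γ)` a function of the BOUNDARY DATA of `Fix γ` alone.  Written by F0P3a-p08 (g17) as a GENERIC organ (pure graph theory).  HONEST LABEL: HC_CM is proved only
modulo the printed citations (the 2 remaining named inputs hLiu418, h413) until rung 0 closes; nothing printed about unitary groups is asserted here.

THE MATHEMATICS ([Serre1980Trees] I.2.3: projection onto a subtree).  `G` a locally finite tree, `Y ⊆ V` a subtree, `(h, p)` the height∕parent data of ★ `exists_retraction` — used
here only through three of its clauses, taken as HYPOTHESES so that any retraction-shaped data instantiates them: (P1) `h v = 0 ↔ v ∈ Y`; (P2) for `v ∉ Y`, `v ~ p v` and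
`h (p v) + 1 = h v`; (P5) for `v ∉ Y`, every neighbour `w ≠ p v` has `h w = h v + 1` and `p w = v`.  Layers `L_k = {v | h v = k}` (`L_0 = Y`).  Then the children
`{w ~ v | h w = h v + 1}` of `v ∉ Y` are `N(v) ∖ {p v}` (`deg v − 1` of them), the children of `y ∈ Y` are `N(y) ∖ Y`, and `L_{k+1}` is the DISJOINT union of the children of the
points of `L_k` (the down-neighbour of a vertex off `Y` is unique).  Hence (§2) `#L_{k+1} = Σ_{v ∈ L_k} #children(v)` (all layers finite when `Y` is), `= Σ (deg v − 1)` for `k ≥ 1`;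
(§3) if `G` carries a type function `c : V → Fin 2` with adjacent vertices of different types and `deg v = q (c v) + 1` off `Y`, then for `k ≥ 1` and `i ≠ j`:
`#(L_{k+1} ∩ c⁻¹ i) = q j · #(L_k ∩ c⁻¹ j)`; (§4) around a single vertex `Y = {r}` (spheres `S_m(r) = {v | G.dist r v = m}`, ★ retraction heights = distances):
`#S_{m+1}(r)` by the recursion, and in the bi-regular case the CLOSED FORM `#S_m(r) = (q_{c r} + 1) · q_{c′}^{⌊m∕2⌋} · q_{c r}^{⌊(m−1)∕2⌋}` (`c′ ≠ c r`, `m ≥ 1`) — e.g. `(q³ + 1)·q` vertices at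
distance `2` from a hyperspecial vertex of the `(q³+1, q+1)`-tree of `U(2,1)` (S3-T0 KILL-CHECK 1, ★ `HyperspecialUnitaryRankOneHeckeNeighbours` «`q⁴ + q`»).

* §1 `children_eq_erase`, `card_children_eq_degree_sub_one` (off `Y`), `children_eq_filter_not_mem` (on `Y`), `parent_eq_of_adj_of_height` (uniqueness of the down-neighbour).
* §2 **`exists_finset_layer_succ`** (the Finset form: `L_{k+1}` as the disjoint `biUnion` of children, with its cardinality), **`finite_layer`** (all layers finite if `Y` is),
  **`ncard_layer_succ_eq_sum`** (`#L_{k+1} = Σ_{v ∈ L_k} (deg v − 1)`, `k ≥ 1`).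
* §3 **`ncard_layer_succ_inter_type_eq`** — the two-type recursion `#(L_{k+1} ∩ type i) = q j · #(L_k ∩ type j)`.
* §4 `connected_induce_singleton`, `height_eq_dist_of_singleton`, `type_eq_iff_even_dist` (types alternate along geodesics), **`ncard_sphere_succ_inter_type_eq`** ∕ **`ncard_sphere_eq_of_biregular`** — spheres around a vertex of a bi-regular tree.

## References
* [Serre1980Trees] J.-P. Serre, *Trees*, Springer (1980): I.2.3 (projection onto a subtree; the layers), II.1.1 (the tree of `SL₂`: `(q+1)q^{m−1}` vertices at distance `m`).
* [Diestel2010] R. Diestel, *Graph Theory*, 4th ed., Thm. 1.5.1, Prop. 1.5.2 (unique paths; normal trees).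
-/

set_option autoImplicit false

open SimpleGraph Finset

namespace Literature.Combinatorics.SimpleGraph.TreeLayers

/-- Bookkeeping in `Fin 2`: if `x ≠ y` and `z ≠ y` then `z = x`. [cite: Serre1980Trees, I.2.3] -/
theorem fin_two_eq_of_ne_of_ne : ∀ {x y z : Fin 2}, x ≠ y → z ≠ y → z = x := by decide

variable {V : Type*} {G : SimpleGraph V} [G.LocallyFinite]

section Retraction

variable {Y : Set V} {h : V → ℕ} {p : V → V}
  (h0 : ∀ v, h v = 0 ↔ v ∈ Y) (hpar : ∀ v, v ∉ Y → G.Adj v (p v) ∧ h (p v) + 1 = h v)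
  (hchild : ∀ v w, v ∉ Y → G.Adj v w → w ≠ p v → h w = h v + 1 ∧ p w = v)

/-! ## §1 Children -/

omit [G.LocallyFinite] in
include hchild in
/-- **Uniqueness of the down-neighbour**: a neighbour `v` of `w ∉ Y` with `h w = h v + 1` is the parent `p w`. [cite: Serre1980Trees, I.2.3] -/
theorem parent_eq_of_adj_of_height {v w : V} (hw : w ∉ Y) (hadj : G.Adj w v) (hh : h w = h v + 1) : p w = v := by
  by_contra hne
  have := (hchild w v hw hadj (fun heq => hne heq.symm)).1
  omega

include hpar hchild in
/-- **The children of `v ∉ Y` are its neighbours other than its parent**: `{w ∈ N(v) | h w = h v + 1} = N(v) ∖ {p v}`. [cite: Serre1980Trees, I.2.3] -/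
theorem children_eq_erase [DecidableEq V] {v : V} (hv : v ∉ Y) :
    (G.neighborFinset v).filter (fun w => h w = h v + 1) = (G.neighborFinset v).erase (p v) := by
  ext w
  rw [mem_filter, mem_erase, mem_neighborFinset]
  constructor
  · rintro ⟨hadj, hh⟩
    refine ⟨?_, hadj⟩
    rintro rfl
    have := (hpar v hv).2
    omega
  · rintro ⟨hne, hadj⟩
    exact ⟨hadj, (hchild v w hv hadj hne).1⟩

include hpar hchild in
/-- **A vertex `v ∉ Y` has exactly `deg v − 1` children.** [cite: Serre1980Trees, I.2.3] -/
theorem card_children_eq_degree_sub_one [DecidableEq V] {v : V} (hv : v ∉ Y) :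
    ((G.neighborFinset v).filter (fun w => h w = h v + 1)).card = G.degree v - 1 := by
  rw [children_eq_erase hpar hchild hv, card_erase_of_mem ((mem_neighborFinset _ _ _).2 (hpar v hv).1), card_neighborFinset_eq_degree]

include h0 hpar hchild in
/-- **The children of `y ∈ Y` are its neighbours outside `Y`** (a neighbour `w ∉ Y` of `y` has `p w = y`, hence `h w = 1`). [cite: Serre1980Trees, I.2.3] -/
theorem children_eq_filter_not_mem [DecidableEq V] [DecidablePred (· ∈ Y)] {y : V} (hy : y ∈ Y) :
    (G.neighborFinset y).filter (fun w => h w = h y + 1) = (G.neighborFinset y).filter (fun w => w ∉ Y) := by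
  have hy0 : h y = 0 := (h0 y).2 hy
  ext w
  rw [mem_filter, mem_filter, mem_neighborFinset]
  constructor
  · rintro ⟨hadj, hh⟩
    refine ⟨hadj, fun hw => ?_⟩
    have := (h0 w).2 hw
    omega
  · rintro ⟨hadj, hw⟩
    refine ⟨hadj, ?_⟩
    -- `y` is the down-neighbour of `w`: otherwise `h y = h w + 1 ≥ 1`
    have hpw : p w = y := by
      by_contra hne
      have := (hchild w y hw hadj.symm (fun heq => hne heq.symm)).1
      omega
    have := (hpar w hw).2
    rw [hpw] at this
    omega

end Retraction

section Layers

variable {Y : Set V} {h : V → ℕ} {p : V → V}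
  (h0 : ∀ v, h v = 0 ↔ v ∈ Y) (hpar : ∀ v, v ∉ Y → G.Adj v (p v) ∧ h (p v) + 1 = h v)
  (hchild : ∀ v w, v ∉ Y → G.Adj v w → w ≠ p v → h w = h v + 1 ∧ p w = v)

/-! ## §2 `L_{k+1}` is the disjoint union of the children of `L_k` -/

include h0 hpar hchild in
/-- **THE LAYER RECURSION (Finset form).**  If `L_k = {v | h v = k}` is the finite set `s`, then `L_{k+1}` is the finite set `s.biUnion children` — a DISJOINT union (the down-neighbour
is unique) — so `#L_{k+1} = Σ_{v ∈ L_k} #children(v)`. [cite: Serre1980Trees, I.2.3] -/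
theorem exists_finset_layer_succ [DecidableEq V] {k : ℕ} {s : Finset V} (hs : ∀ v, v ∈ s ↔ h v = k) :
    ∃ t : Finset V, (∀ w, w ∈ t ↔ h w = k + 1) ∧ t.card = ∑ v ∈ s, ((G.neighborFinset v).filter (fun w => h w = h v + 1)).card := by
  refine ⟨s.biUnion (fun v => (G.neighborFinset v).filter (fun w => h w = h v + 1)), fun w => ?_, ?_⟩
  · rw [mem_biUnion]
    constructor
    · rintro ⟨v, hv, hw⟩
      rw [mem_filter] at hw
      rw [hw.2, (hs v).1 hv]
    · intro hw
      have hwY : w ∉ Y := fun hY => by have := (h0 w).2 hY; omega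
      obtain ⟨hadj, hh⟩ := hpar w hwY
      refine ⟨p w, (hs (p w)).2 (by omega), ?_⟩
      rw [mem_filter, mem_neighborFinset]
      exact ⟨hadj.symm, by omega⟩
  · apply card_biUnion
    intro v hv v' hv' hne
    rw [Function.onFun, Finset.disjoint_left]
    intro w hw hw'
    rw [mem_filter, mem_neighborFinset] at hw hw'
    have hwY : w ∉ Y := fun hY => by have := (h0 w).2 hY; omega
    have h1 : p w = v := parent_eq_of_adj_of_height hchild hwY hw.1.symm hw.2
    have h2 : p w = v' := parent_eq_of_adj_of_height hchild hwY hw'.1.symm hw'.2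
    exact hne (h1.symm.trans h2)

include h0 hpar hchild in
/-- **All layers are finite when `Y` is** (locally finite tree). [cite: Serre1980Trees, I.2.3] -/
theorem finite_layer (hY : Y.Finite) (k : ℕ) : {v | h v = k}.Finite := by
  classical
  induction k with
  | zero =>
    refine hY.subset fun v hv => (h0 v).1 hv
  | succ k ih =>
    obtain ⟨t, ht, -⟩ := exists_finset_layer_succ h0 hpar hchild (s := ih.toFinset) (fun v => by rw [Set.Finite.mem_toFinset]; rfl)
    refine t.finite_toSet.subset fun w hw => ?_
    rw [Finset.mem_coe, ht]
    exact hw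

include h0 hpar hchild in
/-- **`#L_{k+1} = Σ_{v ∈ L_k} (deg v − 1)` for `k ≥ 1`** (each `v ∈ L_k` lies off `Y` and has `deg v − 1` children; `Y` finite). [cite: Serre1980Trees, I.2.3] -/
theorem ncard_layer_succ_eq_sum (hY : Y.Finite) {k : ℕ} (hk : 1 ≤ k) :
    {w | h w = k + 1}.ncard = ∑ v ∈ (finite_layer h0 hpar hchild hY k).toFinset, (G.degree v - 1) := by
  classical
  have hs : ∀ v, v ∈ (finite_layer h0 hpar hchild hY k).toFinset ↔ h v = k := fun v => by rw [Set.Finite.mem_toFinset]; rfl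
  obtain ⟨t, ht, hcard⟩ := exists_finset_layer_succ h0 hpar hchild hs
  have hset : {w | h w = k + 1} = (t : Set V) := by
    ext w
    rw [Set.mem_setOf_eq, Finset.mem_coe, ht]
  rw [hset, Set.ncard_coe_finset, hcard]
  refine Finset.sum_congr rfl fun v hv => ?_
  have hvY : v ∉ Y := fun hY => by have := (h0 v).2 hY; rw [(hs v).1 hv] at this; omega
  convert card_children_eq_degree_sub_one hpar hchild hvY

/-! ## §3 The two-type recursion -/

include h0 hpar hchild in
/-- **THE TWO-TYPE LAYER RECURSION.**  Let `c : V → Fin 2` be a type function with `c v ≠ c w` along every edge, and suppose every vertex off `Y` of type `j` has degree `q j + 1`.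
Then for `k ≥ 1` and `i ≠ j` the type-`i` part of `L_{k+1}` consists of the children of the type-`j` part of `L_k`, `q j` children each:
`#(L_{k+1} ∩ c⁻¹{i}) = q j · #(L_k ∩ c⁻¹{j})` (and these sets are finite when `Y` is). [cite: Serre1980Trees, I.2.3] -/
theorem ncard_layer_succ_inter_type_eq (hY : Y.Finite) (c : V → Fin 2) (hc : ∀ v w, G.Adj v w → c v ≠ c w) (q : Fin 2 → ℕ)
    (hdeg : ∀ v, v ∉ Y → G.degree v = q (c v) + 1) {i j : Fin 2} (hij : i ≠ j) {k : ℕ} (hk : 1 ≤ k) :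
    {w | h w = k + 1 ∧ c w = i}.ncard = q j * {v | h v = k ∧ c v = j}.ncard := by
  classical
  have hfk := finite_layer h0 hpar hchild hY k
  -- the type-`j` part of `L_k` as a Finset
  set s : Finset V := hfk.toFinset.filter (fun v => c v = j) with hsdef
  have hs : ∀ v, v ∈ s ↔ h v = k ∧ c v = j := fun v => by
    rw [hsdef, mem_filter, Set.Finite.mem_toFinset]; rfl
  have hsj : {v | h v = k ∧ c v = j} = (s : Set V) := by
    ext v; rw [Set.mem_setOf_eq, Finset.mem_coe, hs]
  -- the type-`i` part of `L_{k+1}` is the disjoint union of the children of `s`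
  set t : Finset V := s.biUnion (fun v => (G.neighborFinset v).filter (fun w => h w = h v + 1)) with htdef
  have hother : ∀ v w, G.Adj v w → (c w = i ↔ c v = j) := by
    intro v w hadj
    have hne := hc v w hadj
    constructor
    · intro hwi
      exact fin_two_eq_of_ne_of_ne hij.symm (by rw [← hwi]; exact hne)
    · intro hvj
      exact fin_two_eq_of_ne_of_ne hij (by rw [← hvj]; exact fun heq => hne heq.symm)
  have ht : ∀ w, w ∈ t ↔ h w = k + 1 ∧ c w = i := by
    intro w
    rw [htdef, mem_biUnion]
    constructor
    · rintro ⟨v, hv, hw⟩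
      rw [mem_filter, mem_neighborFinset] at hw
      obtain ⟨hvk, hvj⟩ := (hs v).1 hv
      exact ⟨by rw [hw.2, hvk], (hother v w hw.1).2 hvj⟩
    · rintro ⟨hw, hwi⟩
      have hwY : w ∉ Y := fun hY' => by have := (h0 w).2 hY'; omega
      obtain ⟨hadj, hh⟩ := hpar w hwY
      refine ⟨p w, (hs (p w)).2 ⟨by omega, (hother (p w) w hadj.symm).1 hwi⟩, ?_⟩
      rw [mem_filter, mem_neighborFinset]
      exact ⟨hadj.symm, by omega⟩
  have hti : {w | h w = k + 1 ∧ c w = i} = (t : Set V) := by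
    ext w; rw [Set.mem_setOf_eq, Finset.mem_coe, ht]
  have hcard : t.card = ∑ v ∈ s, ((G.neighborFinset v).filter (fun w => h w = h v + 1)).card := by
    apply card_biUnion
    intro v hv v' hv' hne
    rw [Function.onFun, Finset.disjoint_left]
    intro w hw hw'
    rw [mem_filter, mem_neighborFinset] at hw hw'
    have hwY : w ∉ Y := fun hY' => by
      have := (h0 w).2 hY'
      have := ((hs v).1 hv).1
      omega
    have h1 : p w = v := parent_eq_of_adj_of_height hchild hwY hw.1.symm hw.2
    have h2 : p w = v' := parent_eq_of_adj_of_height hchild hwY hw'.1.symm hw'.2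
    exact hne (h1.symm.trans h2)
  rw [hti, hsj, Set.ncard_coe_finset, Set.ncard_coe_finset, hcard, mul_comm]
  refine Finset.sum_const_nat fun v hv => ?_
  obtain ⟨hvk, hvj⟩ := (hs v).1 hv
  have hvY : v ∉ Y := fun hY' => by have := (h0 v).2 hY'; omega
  rw [card_children_eq_degree_sub_one hpar hchild hvY, hdeg v hvY, hvj, Nat.add_sub_cancel]

end Layers

/-! ## §4 Spheres around a vertex -/

omit [G.LocallyFinite] in
/-- A single vertex induces a connected subgraph. [cite: Diestel2010, Prop. 1.5.2] -/
theorem connected_induce_singleton (r : V) : (G.induce ({r} : Set V)).Connected := by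
  haveI : Nonempty ({r} : Set V) := ⟨⟨r, rfl⟩⟩
  refine Connected.mk fun a b => ?_
  have hab : a = b := Subtype.ext (a.2.trans b.2.symm)
  rw [hab]

omit [G.LocallyFinite] in
/-- **Retraction data toward a single vertex `r` are the distances from `r`**: `h v = G.dist r v`. [cite: Serre1980Trees, I.2.3] -/
theorem height_eq_dist_of_singleton {r : V} {h : V → ℕ} (hdist : ∀ v, (∃ y ∈ ({r} : Set V), G.dist v y = h v) ∧ ∀ y ∈ ({r} : Set V), h v ≤ G.dist v y) (v : V) :
    h v = G.dist r v := by
  obtain ⟨y, hy, hd⟩ := (hdist v).1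
  rw [Set.mem_singleton_iff] at hy
  rw [← hd, hy, dist_comm]

/-- **THE TWO-TYPE SPHERE RECURSION AROUND A VERTEX** of a locally finite tree with a type function `c` (adjacent vertices of different types) and degrees `q (c v) + 1`:
for `m ≥ 1` and `i ≠ j`, `#{v | dist r v = m + 1, c v = i} = q j · #{v | dist r v = m, c v = j}`. [cite: Serre1980Trees, I.2.3] [cite: Serre1980Trees, II.1.1] -/
theorem ncard_sphere_succ_inter_type_eq (hT : G.IsTree) (r : V) (c : V → Fin 2) (hc : ∀ v w, G.Adj v w → c v ≠ c w) (q : Fin 2 → ℕ)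
    (hdeg : ∀ v, v ≠ r → G.degree v = q (c v) + 1) {i j : Fin 2} (hij : i ≠ j) {m : ℕ} (hm : 1 ≤ m) :
    {w | G.dist r w = m + 1 ∧ c w = i}.ncard = q j * {v | G.dist r v = m ∧ c v = j}.ncard := by
  obtain ⟨h, p, hdist, h0, hpar, -, hchild, -⟩ :=
    TreeRetraction.exists_retraction hT (Y := ({r} : Set V)) ⟨r, rfl⟩ (connected_induce_singleton r)
  have hh : ∀ v, h v = G.dist r v := height_eq_dist_of_singleton hdist
  have h0' : ∀ v, h v = 0 ↔ v ∈ ({r} : Set V) := h0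
  have key := ncard_layer_succ_inter_type_eq h0' hpar hchild (Set.finite_singleton r) c hc q
    (fun v hv => hdeg v (fun heq => hv (Set.mem_singleton_iff.2 heq))) hij hm
  simp only [hh] at key
  exact key

omit [G.LocallyFinite] in
/-- In a tree with a proper type function, **the type of a vertex at distance `m` from `r` is determined by the parity of `m`**: `c v = c r ↔ Even (G.dist r v)`.
[cite: Serre1980Trees, I.2.3] -/
theorem type_eq_iff_even_dist (hT : G.IsTree) (r : V) (c : V → Fin 2) (hc : ∀ v w, G.Adj v w → c v ≠ c w) (v : V) : c v = c r ↔ Even (G.dist r v) := by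
  -- along a geodesic from `r` the type alternates
  obtain ⟨W, hW⟩ := hT.1.exists_walk_length_eq_dist r v
  rw [← hW]
  clear hW
  induction W with
  | nil => simp
  | @cons a b z hab W ih =>
    rw [Walk.length_cons, Nat.even_add_one, ← ih]
    have hne := hc a b hab
    constructor
    · intro hza hzb
      exact hne (hza.symm.trans hzb)
    · intro hzb
      exact fin_two_eq_of_ne_of_ne hne hzb

/-- **THE SPHERES OF A BI-REGULAR TREE** (closed form): if adjacent vertices have different types and every vertex `v ≠ r` has degree `q (c v) + 1`, while `r` has degree `q (c r) + 1` too,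
then for `m ≥ 1`, with `a = c r` and `b ≠ a`:  `#{v | G.dist r v = m} = (q a + 1) · (q b)^{⌊m∕2⌋} · (q a)^{⌊(m−1)∕2⌋}`.  (For the `(q³+1, q+1)`-tree of `U(2,1)` around a hyperspecial
vertex: `q³+1`, `(q³+1)q`, `(q³+1)q·q³`, … .) [cite: Serre1980Trees, II.1.1] -/
theorem ncard_sphere_eq_of_biregular (hT : G.IsTree) (r : V) (c : V → Fin 2) (hc : ∀ v w, G.Adj v w → c v ≠ c w) (q : Fin 2 → ℕ)
    (hdeg : ∀ v, G.degree v = q (c v) + 1) {a b : Fin 2} (ha : c r = a) (hab : a ≠ b) {m : ℕ} (hm : 1 ≤ m) :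
    {v | G.dist r v = m}.ncard = (q a + 1) * q b ^ (m / 2) * q a ^ ((m - 1) / 2) := by
  classical
  -- typed spheres: at distance `m` every vertex has the type of parity `m`
  have htype : ∀ m v, G.dist r v = m → c v = if Even m then a else b := by
    intro m v hv
    have hiff := type_eq_iff_even_dist hT r c hc v
    rw [hv, ha] at hiff
    split_ifs with hpar
    · exact hiff.2 hpar
    · exact fin_two_eq_of_ne_of_ne hab.symm (fun heq => hpar (hiff.1 heq))
  have hsphere : ∀ m, {v | G.dist r v = m} = {v | G.dist r v = m ∧ c v = if Even m then a else b} := by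
    intro m; ext v
    simp only [Set.mem_setOf_eq]
    exact ⟨fun hv => ⟨hv, htype m v hv⟩, fun hv => hv.1⟩
  -- induction on `m ≥ 1`
  induction m, hm using Nat.le_induction with
  | base =>
    -- the sphere of radius 1 is the neighbourhood of `r`
    have h1 : {v | G.dist r v = 1} = (G.neighborFinset r : Set V) := by
      ext v
      rw [Set.mem_setOf_eq, Finset.mem_coe, mem_neighborFinset, dist_eq_one_iff_adj]
    rw [h1, Set.ncard_coe_finset, card_neighborFinset_eq_degree, hdeg r, ha]
    simp
  | succ m hm ih =>
    have hij' : (if Even (m + 1) then a else b) ≠ (if Even m then a else b) := by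
      rcases Nat.even_or_odd m with hev | hodd
      · have h1 : ¬ Even (m + 1) := fun h' => by rw [Nat.even_add_one] at h'; exact h' hev
        rw [if_neg h1, if_pos hev]; exact hab.symm
      · have h1 : ¬ Even m := Nat.not_even_iff_odd.2 hodd
        have h2 : Even (m + 1) := by rw [Nat.even_add_one]; exact h1
        rw [if_pos h2, if_neg h1]; exact hab
    have hrec := ncard_sphere_succ_inter_type_eq hT r c hc q (fun v _ => hdeg v) hij' hm
    rw [hsphere (m + 1), hrec, ← hsphere m, ih]
    -- arithmetic of the exponents
    rcases Nat.even_or_odd m with hev | hodd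
    · rw [if_pos hev]
      obtain ⟨t, rfl⟩ := hev
      have ht : t ≠ 0 := by omega
      obtain ⟨t, rfl⟩ := Nat.exists_eq_succ_of_ne_zero ht
      have e1 : (t.succ + t.succ + 1) / 2 = t + 1 := by omega
      have e2 : (t.succ + t.succ + 1 - 1) / 2 = t + 1 := by omega
      have e3 : (t.succ + t.succ) / 2 = t + 1 := by omega
      have e4 : (t.succ + t.succ - 1) / 2 = t := by omega
      rw [e1, e2, e3, e4, pow_succ (q a) t]
      ring
    · have h1 : ¬ Even m := Nat.not_even_iff_odd.2 hodd
      rw [if_neg h1]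
      obtain ⟨t, rfl⟩ := hodd
      have e1 : (2 * t + 1 + 1) / 2 = t + 1 := by omega
      have e2 : (2 * t + 1 + 1 - 1) / 2 = t := by omega
      have e3 : (2 * t + 1) / 2 = t := by omega
      have e4 : (2 * t + 1 - 1) / 2 = t := by omega
      rw [e1, e2, e3, e4, pow_succ (q b) t]
      ring

end Literature.Combinatorics.SimpleGraph.TreeLayers
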